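import Mathlib
import HarnessLib
import Literature.NumberTheory.LFunctions.ZetaSubconvexity
import Literature.NumberTheory.LFunctions.ApproxFunctionalEquation
import Literature.NumberTheory.LFunctions.RobertSargosFourthDerivative

/-!
# Bourgain's Theorem 5 from Theorem 4 and the Robert–Sargos test alone

Topic `Literature/NumberTheory/LFunctions`. Fourth file of the decomposition of the named fact
`Literature.NumberTheory.LFunctions.bourgain_subconvexity` (Bourgain, *J. Amer. Math. Soc.* **30**
(2017), Theorem 5: `|ζ(1/2 + it)| ≪ |t|^{13/84 + ε}`), after `ZetaSubconvexity.lean`,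
`ZetaSubconvexityProofs.lean` and `ApproxFunctionalEquation.lean`. There the frontier was
`Literature.NumberTheory.LFunctions.bourgain_subconvexity_of_theorem4_of_eq41'`: Theorem 5 from
Bourgain's Theorem 4 (eq. (3.19) for `17/42 ≤ α = log M / log T ≤ 1/2`,
`Literature.NumberTheory.LFunctions.Bourgain2017_theorem4_log`) and Huxley's estimate (4.1)
(`Literature.NumberTheory.LFunctions.Bourgain2017_eq41_log`, Huxley 1993 Thm 3, the
Bombieri–Iwaniec–Huxley method), which §5 of the paper uses on `12/31 < α < 17/42`.

This file removes (4.1) from that list, using the Robert–Sargos fourth-derivative test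
(`Literature.NumberTheory.LFunctions.Sargos2003_lemma4`, file `RobertSargosFourthDerivative.lean`:
`∑_{m ≤ M} e(g(m)) ≪_ε M^ε (M λ₄^{1/13} + λ₄^{-7/13})` for `λ₄ ≤ g⁽⁴⁾ ≪ λ₄`). For Bourgain's sum
`S = ∑_{M/2 ≤ m ≤ M} e(T log(m/M))` one has `λ₄ ≍ T/M⁴`, and
`M (T/M⁴)^{1/13} = M^{9/13} T^{1/13} ≤ M^{1/2} T^{13/84}` iff `M^{5/26} ≤ T^{85/1092}` iff
`α ≤ (85/1092)(26/5) = 17/42` — exactly the lower end of the range of Theorem 4 — while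
`(T/M⁴)^{-7/13} = M^{28/13} T^{-7/13} ≤ M^{1/2} T^{13/84}` iff `α ≤ 757/1806 = 0.4191… (> 17/42)`.
So (3.19) holds for `F = log` on `0 ≤ α ≤ 17/42` by Robert–Sargos (the range `M⁴ < 120 T`,
`α < 1/4 + o(1)`, and `M < 24` being trivial: `|S| ≤ M ≤ 24 √M T^{13/84}`), and on
`17/42 ≤ α ≤ 1/2` by Theorem 4.

* `Literature.NumberTheory.LFunctions.norm_bourgainSum_log_le_of_sargos` — PROVED: for `T ≥ 1`,
  `M ≥ 24`, `120 T ≤ M⁴`: `‖S‖ ≤ C M^ε (M^{9/13} T^{1/13} + M^{28/13} T^{-7/13})` (reindex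
  `m = j + ⌈M/2⌉ - 1`, conjugate, apply the test to `g(x) = -T(log(x + ⌈M/2⌉ - 1) - log M)` with
  `λ₄ = 6T/⌊M⌋⁴ ≤ 1/10`, `g⁽⁴⁾ ∈ [λ₄, 16 λ₄]`).
* `Literature.NumberTheory.LFunctions.Bourgain2017_eq51_log_of_theorem4_of_sargos` — PROVED:
  (5.1) for `F = log` (`Literature.NumberTheory.LFunctions.Bourgain2017_eq51_log`) from Theorem 4
  and the Robert–Sargos test alone.
* `Literature.NumberTheory.LFunctions.bourgain_subconvexity_of_theorem4_of_sargos` — PROVED: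
  `Bourgain2017_theorem4_log → Sargos2003_lemma4 → bourgain_subconvexity` (the approximate
  functional equation (4.3) being the theorem
  `Literature.NumberTheory.LFunctions.Bourgain2017_eq43_holds`); also the variant
  `…_of_sargos_of_eq43` with (4.3) as a hypothesis.

So the discharge of Bourgain's Theorem 5 now rests on Bourgain's Theorem 4 (`ℓ²`-decoupling,
Thms 1–2 / Cor. 3 (2.28) of the paper — the mean value `Literature.NumberTheory.LFunctions.bourgainA6`
of `BourgainDecouplingMeanValue.lean`, where (2.28) enters the proved reductions as an explicit
hypothesis — fed into the Bombieri–Iwaniec–Huxley–Watt machinery) and on the Robert–Sargos test, an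
elementary and precisely stated result, in place of Huxley 1993, Thm 3; the exponent pair (4.2)
and the classical fourth-derivative test (`ZetaSubconvexityProofs.lean`) are not used either.

## References

* J. Bourgain, *Decoupling, exponential sums and the Riemann zeta function*, J. Amer. Math. Soc.
  30 (2017), 205–224 — Theorem 4 (3.19), §5 ("The cases with `0 ≤ α ≤ 13/42` are trivial"),
  (5.1), Theorem 5.
* O. Robert, P. Sargos, *A fourth derivative test for exponential sums*, Compositio Math. 130
  (2002), 275–292, Theorem 1; P. Sargos, Acta Arith. 110 (2003), Lemma 4.
-/

noncomputable section

open Complex Finset Filter Asymptotics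
open scoped Real

namespace Literature.NumberTheory.LFunctions

/-! ## The Robert–Sargos test applied to `∑_{M/2 ≤ m ≤ M} e(T log(m/M))` -/

/-- The trivial bound `‖∑_{M/2 ≤ m ≤ M} e(T log(m/M))‖ ≤ M` for `M ≥ 1`. [folklore] -/
theorem norm_bourgainSum_le_self (F : ℝ → ℝ) (T : ℝ) {M : ℝ} (hM : 1 ≤ M) :
    ‖bourgainSum F T M‖ ≤ M := by
  refine (norm_bourgainSum_le_card F T M).trans ?_
  have h1 : 1 ≤ ⌈M / 2⌉₊ := Nat.one_le_iff_ne_zero.2 (Nat.ceil_pos.2 (by linarith)).ne'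
  have hcard : (Finset.Icc ⌈M / 2⌉₊ ⌊M⌋₊).card ≤ ⌊M⌋₊ := by
    rw [Nat.card_Icc]; omega
  calc ((Finset.Icc ⌈M / 2⌉₊ ⌊M⌋₊).card : ℝ) ≤ ⌊M⌋₊ := by exact_mod_cast hcard
    _ ≤ M := Nat.floor_le (by linarith)

/-- **Reindexing and conjugation**: for `M ≥ 4`, with `a = ⌈M/2⌉`, `b = ⌊M⌋`, `K = b + 1 - a`,
`‖∑_{a ≤ m ≤ b} e(T log(m/M))‖ = ‖∑_{1 ≤ j ≤ K} e(g(j))‖` for the model phase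
`g(x) = -T (log(x + (a - 1)) - log M)` (shift `m = j + a - 1`, then complex conjugation).
[folklore] -/
theorem norm_bourgainSum_log_eq_model (T : ℝ) {M : ℝ} (hM : 4 ≤ M) :
    ‖bourgainSum Real.log T M‖ =
      ‖∑ j ∈ Finset.Icc 1 (⌊M⌋₊ + 1 - ⌈M / 2⌉₊), Complex.exp (2 * ↑π * I *
        ↑(-T * (Real.log ((j : ℝ) + ((⌈M / 2⌉₊ : ℝ) - 1)) - Real.log M)))‖ := by
  have hM0 : 0 < M := by linarith
  set a : ℕ := ⌈M / 2⌉₊ with ha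
  set b : ℕ := ⌊M⌋₊ with hb
  have ha_ge : M / 2 ≤ a := Nat.le_ceil _
  have ha_lt : (a : ℝ) < M / 2 + 1 := Nat.ceil_lt_add_one (by positivity)
  have hb_gt : M < b + 1 := Nat.lt_floor_add_one M
  have ha1 : 1 ≤ a := by
    have : (1 : ℝ) ≤ a := by linarith
    exact_mod_cast this
  have hab : a ≤ b := by
    have : (a : ℝ) < b := by linarith
    exact_mod_cast this.le
  set c : ℝ := (a : ℝ) - 1 with hc
  -- reindex `m = j + (a - 1)`
  have hsum : bourgainSum Real.log T M = ∑ j ∈ Finset.Icc 1 (b + 1 - a),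
      Complex.exp (2 * ↑π * I * ↑(T * Real.log (((j : ℝ) + c) / M))) := by
    unfold bourgainSum
    have hIcc : Finset.Icc a b = (Finset.Icc 1 (b + 1 - a)).map (addRightEmbedding (a - 1)) := by
      rw [Finset.map_add_right_Icc]; congr 1 <;> omega
    rw [hIcc, Finset.sum_map]
    refine Finset.sum_congr rfl fun j _ => ?_
    have hcast : (((addRightEmbedding (a - 1)) j : ℕ) : ℝ) = (j : ℝ) + c := by
      rw [addRightEmbedding_apply, Nat.cast_add, Nat.cast_sub ha1]; push_cast; rw [hc]
    rw [hcast]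
  rw [hsum, ← norm_sum_exp_neg]
  congr 1
  refine Finset.sum_congr rfl fun j hj => ?_
  have hj1 : (1 : ℝ) ≤ j := by exact_mod_cast (Finset.mem_Icc.1 hj).1
  have hjc : 0 < (j : ℝ) + c := by
    have : (1 : ℝ) ≤ a := by exact_mod_cast ha1
    rw [hc]; linarith
  rw [Real.log_div hjc.ne' hM0.ne']
  congr 2
  push_cast
  ring

/-- **Simplification of the Robert–Sargos bound** `K^ε (K λ^{1/13} + λ^{-7/13})` when `K ≤ M` and
`T/M⁴ ≤ λ ≤ 96 T/M⁴`: it is at most `2 M^ε (M^{9/13} T^{1/13} + M^{28/13} T^{-7/13})`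
(`96^{1/13} ≤ 2`). [folklore] -/
theorem rs_bound_simplify {T M K lam ε : ℝ} (hT : 0 < T) (hM : 0 < M) (hε : 0 ≤ ε)
    (hK0 : 0 ≤ K) (hKM : K ≤ M) (hlam0 : 0 < lam) (hle : lam ≤ 96 * T / M ^ 4)
    (hge : T / M ^ 4 ≤ lam) :
    K ^ ε * (K * lam ^ (1 / 13 : ℝ) + lam ^ (-(7 / 13 : ℝ))) ≤
      2 * (M ^ ε * (M ^ (9 / 13 : ℝ) * T ^ (1 / 13 : ℝ) + M ^ (28 / 13 : ℝ) * T ^ (-(7 / 13 : ℝ)))) := by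
  have hKε : K ^ ε ≤ M ^ ε := Real.rpow_le_rpow hK0 hKM hε
  -- first term: `λ^{1/13} ≤ (96 T/M⁴)^{1/13} ≤ 2 T^{1/13} M^{-4/13}`
  have h96 : (96 : ℝ) ^ (1 / 13 : ℝ) ≤ 2 := by
    calc (96 : ℝ) ^ (1 / 13 : ℝ) ≤ ((2 : ℝ) ^ (13 : ℕ)) ^ (1 / 13 : ℝ) :=
          Real.rpow_le_rpow (by norm_num) (by norm_num) (by norm_num)
      _ = 2 := by
          rw [← Real.rpow_natCast 2 13, ← Real.rpow_mul (by norm_num)]; norm_num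
  have hM4 : (M ^ 4) ^ (1 / 13 : ℝ) = M ^ (4 / 13 : ℝ) := by
    rw [← Real.rpow_natCast M 4, ← Real.rpow_mul hM.le]; norm_num
  have hterm1 : K * lam ^ (1 / 13 : ℝ) ≤ 2 * (M ^ (9 / 13 : ℝ) * T ^ (1 / 13 : ℝ)) := by
    have h1 : lam ^ (1 / 13 : ℝ) ≤ (96 * T / M ^ 4) ^ (1 / 13 : ℝ) :=
      Real.rpow_le_rpow hlam0.le hle (by norm_num)
    have h2 : (96 * T / M ^ 4) ^ (1 / 13 : ℝ) =
        (96 : ℝ) ^ (1 / 13 : ℝ) * T ^ (1 / 13 : ℝ) / M ^ (4 / 13 : ℝ) := by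
      rw [Real.div_rpow (by positivity) (by positivity), Real.mul_rpow (by norm_num) hT.le, hM4]
    have h3 : M ^ (9 / 13 : ℝ) * M ^ (4 / 13 : ℝ) = M := by
      rw [← Real.rpow_add hM]; norm_num
    have hM413 : 0 < M ^ (4 / 13 : ℝ) := by positivity
    have h3' : M / M ^ (4 / 13 : ℝ) = M ^ (9 / 13 : ℝ) := by
      rw [div_eq_iff hM413.ne']; exact h3.symm
    calc K * lam ^ (1 / 13 : ℝ)
        ≤ M * ((96 : ℝ) ^ (1 / 13 : ℝ) * T ^ (1 / 13 : ℝ) / M ^ (4 / 13 : ℝ)) := by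
          rw [← h2]; exact mul_le_mul hKM h1 (by positivity) hM.le
      _ = M / M ^ (4 / 13 : ℝ) * ((96 : ℝ) ^ (1 / 13 : ℝ) * T ^ (1 / 13 : ℝ)) := by ring
      _ = (96 : ℝ) ^ (1 / 13 : ℝ) * (M ^ (9 / 13 : ℝ) * T ^ (1 / 13 : ℝ)) := by rw [h3']; ring
      _ ≤ 2 * (M ^ (9 / 13 : ℝ) * T ^ (1 / 13 : ℝ)) :=
          mul_le_mul_of_nonneg_right h96 (by positivity)
  -- second term: `λ^{-7/13} ≤ (T/M⁴)^{-7/13} = M^{28/13} T^{-7/13}`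
  have hterm2 : lam ^ (-(7 / 13 : ℝ)) ≤ M ^ (28 / 13 : ℝ) * T ^ (-(7 / 13 : ℝ)) := by
    have h1 : lam ^ (-(7 / 13 : ℝ)) ≤ (T / M ^ 4) ^ (-(7 / 13 : ℝ)) :=
      Real.rpow_le_rpow_of_nonpos (by positivity) hge (by norm_num)
    have h2 : (T / M ^ 4) ^ (-(7 / 13 : ℝ)) = M ^ (28 / 13 : ℝ) * T ^ (-(7 / 13 : ℝ)) := by
      rw [Real.div_rpow hT.le (by positivity), ← Real.rpow_natCast M 4, ← Real.rpow_mul hM.le,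
        div_eq_mul_inv, ← Real.rpow_neg hM.le]
      push_cast
      ring_nf
    rw [← h2]; exact h1
  have hpos1 : 0 ≤ M ^ (9 / 13 : ℝ) * T ^ (1 / 13 : ℝ) := by positivity
  have hpos2 : 0 ≤ M ^ (28 / 13 : ℝ) * T ^ (-(7 / 13 : ℝ)) := by positivity
  have hin0 : 0 ≤ K * lam ^ (1 / 13 : ℝ) + lam ^ (-(7 / 13 : ℝ)) := by positivity
  have hKε0 : 0 ≤ K ^ ε := by positivity
  calc K ^ ε * (K * lam ^ (1 / 13 : ℝ) + lam ^ (-(7 / 13 : ℝ)))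
      ≤ M ^ ε * (2 * (M ^ (9 / 13 : ℝ) * T ^ (1 / 13 : ℝ)) + M ^ (28 / 13 : ℝ) * T ^ (-(7 / 13 : ℝ))) :=
        mul_le_mul hKε (add_le_add hterm1 hterm2) hin0 (by positivity)
    _ ≤ 2 * (M ^ ε * (M ^ (9 / 13 : ℝ) * T ^ (1 / 13 : ℝ) + M ^ (28 / 13 : ℝ) * T ^ (-(7 / 13 : ℝ)))) := by
        have : 0 ≤ M ^ ε := by positivity
        nlinarith [mul_nonneg this hpos2]

/-- **The Robert–Sargos test applied to Bourgain's sum with `F = log`**: for `T ≥ 1`, `M ≥ 24`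
and `120 T ≤ M⁴` (so that `λ₄ = 6T/⌊M⌋⁴ ≤ 1/10`), writing the sum over `M/2 ≤ m ≤ M` as a sum
over `1 ≤ j ≤ K` (`K = ⌊M⌋ + 1 - ⌈M/2⌉ ≥ 10`) of `e(g(j))`, `g(x) = -T(log(x + ⌈M/2⌉ - 1) - log M)`,
`g⁽⁴⁾ ∈ [λ₄, 16 λ₄]` (`norm_bourgainSum_log_eq_model`, `logPhase_deriv_bounds`):
`‖∑_{M/2 ≤ m ≤ M} e(T log(m/M))‖ ≤ C M^ε (M^{9/13} T^{1/13} + M^{28/13} T^{-7/13})`.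
[cite: RobertSargos2002, Theorem 1] [cite: Sargos2003, Lemma 4] -/
theorem norm_bourgainSum_log_le_of_sargos (h : Sargos2003_lemma4) {ε : ℝ} (hε : 0 < ε) :
    ∃ C : ℝ, ∀ T : ℝ, 1 ≤ T → ∀ M : ℝ, 24 ≤ M → 120 * T ≤ M ^ 4 →
      ‖bourgainSum Real.log T M‖ ≤
        C * M ^ ε * (M ^ (9 / 13 : ℝ) * T ^ (1 / 13 : ℝ) + M ^ (28 / 13 : ℝ) * T ^ (-(7 / 13 : ℝ))) := by
  obtain ⟨C, hC⟩ := robertSargos_fourthDerivTest h 16 hε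
  refine ⟨2 * |C|, fun T hT M hM hTM => ?_⟩
  have hT0 : 0 < T := by linarith
  have hM0 : 0 < M := by linarith
  -- the integers `a = ⌈M/2⌉`, `b = ⌊M⌋`, `K = b + 1 - a`
  have ha_ge : M / 2 ≤ (⌈M / 2⌉₊ : ℝ) := Nat.le_ceil _
  have ha_lt : ((⌈M / 2⌉₊ : ℕ) : ℝ) < M / 2 + 1 := Nat.ceil_lt_add_one (by positivity)
  have hb_le : ((⌊M⌋₊ : ℕ) : ℝ) ≤ M := Nat.floor_le hM0.le
  have hb_gt : M < (⌊M⌋₊ : ℕ) + 1 := Nat.lt_floor_add_one M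
  have hab : ⌈M / 2⌉₊ ≤ ⌊M⌋₊ + 1 := by
    have : ((⌈M / 2⌉₊ : ℕ) : ℝ) ≤ (⌊M⌋₊ : ℕ) + 1 := by linarith
    exact_mod_cast this
  have hKr : ((⌊M⌋₊ + 1 - ⌈M / 2⌉₊ : ℕ) : ℝ) = (⌊M⌋₊ : ℕ) + 1 - (⌈M / 2⌉₊ : ℕ) := by
    rw [Nat.cast_sub hab]; push_cast; ring
  have hK10 : 10 ≤ ⌊M⌋₊ + 1 - ⌈M / 2⌉₊ := by
    have : (10 : ℝ) ≤ ((⌊M⌋₊ + 1 - ⌈M / 2⌉₊ : ℕ) : ℝ) := by rw [hKr]; linarith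
    exact_mod_cast this
  have hK1r : (1 : ℝ) < ((⌊M⌋₊ + 1 - ⌈M / 2⌉₊ : ℕ) : ℝ) := by rw [hKr]; linarith
  have hKM : ((⌊M⌋₊ + 1 - ⌈M / 2⌉₊ : ℕ) : ℝ) ≤ M := by rw [hKr]; linarith
  have ha1 : (1 : ℝ) ≤ (⌈M / 2⌉₊ : ℕ) := by linarith
  -- `λ₄ = 6T/b⁴`
  have hb0 : (0 : ℝ) < (⌊M⌋₊ : ℕ) := by linarith
  have hb9 : (6561 / 10000 : ℝ) * M ^ 4 ≤ ((⌊M⌋₊ : ℕ) : ℝ) ^ 4 := by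
    have h9 : (9 / 10 : ℝ) * M ≤ (⌊M⌋₊ : ℕ) := by linarith
    have := pow_le_pow_left₀ (by positivity) h9 4
    nlinarith
  have hlam0 : 0 < 6 * T / ((⌊M⌋₊ : ℕ) : ℝ) ^ 4 := by positivity
  have hlam1 : 6 * T / ((⌊M⌋₊ : ℕ) : ℝ) ^ 4 ≤ 1 / 10 := by
    rw [div_le_iff₀ (by positivity)]
    nlinarith
  have hlam_le : 6 * T / ((⌊M⌋₊ : ℕ) : ℝ) ^ 4 ≤ 96 * T / M ^ 4 := by
    have hbM : M / 2 ≤ (⌊M⌋₊ : ℕ) := by linarith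
    have h4 : (M / 2) ^ 4 ≤ ((⌊M⌋₊ : ℕ) : ℝ) ^ 4 := pow_le_pow_left₀ (by positivity) hbM 4
    rw [div_le_div_iff₀ (by positivity) (by positivity),
      show 6 * T * M ^ 4 = 96 * T * (M / 2) ^ 4 by ring]
    exact mul_le_mul_of_nonneg_left h4 (by positivity)
  have hlam_ge : T / M ^ 4 ≤ 6 * T / ((⌊M⌋₊ : ℕ) : ℝ) ^ 4 := by
    have h4 : ((⌊M⌋₊ : ℕ) : ℝ) ^ 4 ≤ M ^ 4 := pow_le_pow_left₀ hb0.le hb_le 4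
    rw [div_le_div_iff₀ (by positivity) (by positivity)]
    calc T * ((⌊M⌋₊ : ℕ) : ℝ) ^ 4 ≤ T * M ^ 4 := mul_le_mul_of_nonneg_left h4 hT0.le
      _ ≤ 6 * T * M ^ 4 := by nlinarith [pow_pos hM0 4]
  -- the phase hypotheses and the test
  have hKb : ((⌊M⌋₊ + 1 - ⌈M / 2⌉₊ : ℕ) : ℝ) + (((⌈M / 2⌉₊ : ℕ) : ℝ) - 1) = (⌊M⌋₊ : ℕ) := by
    rw [hKr]; ring
  have hb2a : ((⌊M⌋₊ : ℕ) : ℝ) ≤ 2 * ((⌈M / 2⌉₊ : ℕ) : ℝ) := by linarith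
  obtain ⟨hgC, hg4⟩ := logPhase_deriv_bounds hT0 ha1 hK1r hKb hb2a (Real.log M)
  have key := hC _ hK10 _ hlam0 hlam1 _ hgC hg4
  rw [← norm_bourgainSum_log_eq_model T (by linarith : (4 : ℝ) ≤ M)] at key
  refine key.trans ?_
  have hs := rs_bound_simplify (ε := ε) hT0 hM0 hε.le (by positivity) hKM hlam0 hlam_le hlam_ge
  have hin0 : 0 ≤ ((⌊M⌋₊ + 1 - ⌈M / 2⌉₊ : ℕ) : ℝ) ^ ε *
      (((⌊M⌋₊ + 1 - ⌈M / 2⌉₊ : ℕ) : ℝ) * (6 * T / ((⌊M⌋₊ : ℕ) : ℝ) ^ 4) ^ (1 / 13 : ℝ) +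
        (6 * T / ((⌊M⌋₊ : ℕ) : ℝ) ^ 4) ^ (-(7 / 13 : ℝ))) := by positivity
  calc C * ((⌊M⌋₊ + 1 - ⌈M / 2⌉₊ : ℕ) : ℝ) ^ ε *
        (((⌊M⌋₊ + 1 - ⌈M / 2⌉₊ : ℕ) : ℝ) * (6 * T / ((⌊M⌋₊ : ℕ) : ℝ) ^ 4) ^ (1 / 13 : ℝ) +
          (6 * T / ((⌊M⌋₊ : ℕ) : ℝ) ^ 4) ^ (-(7 / 13 : ℝ)))
      ≤ |C| * (((⌊M⌋₊ + 1 - ⌈M / 2⌉₊ : ℕ) : ℝ) ^ ε *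
        (((⌊M⌋₊ + 1 - ⌈M / 2⌉₊ : ℕ) : ℝ) * (6 * T / ((⌊M⌋₊ : ℕ) : ℝ) ^ 4) ^ (1 / 13 : ℝ) +
          (6 * T / ((⌊M⌋₊ : ℕ) : ℝ) ^ 4) ^ (-(7 / 13 : ℝ)))) := by
        rw [mul_assoc]; exact mul_le_mul_of_nonneg_right (le_abs_self C) hin0
    _ ≤ |C| * (2 * (M ^ ε * (M ^ (9 / 13 : ℝ) * T ^ (1 / 13 : ℝ) +
          M ^ (28 / 13 : ℝ) * T ^ (-(7 / 13 : ℝ))))) := mul_le_mul_of_nonneg_left hs (abs_nonneg C)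
    _ = 2 * |C| * M ^ ε * (M ^ (9 / 13 : ℝ) * T ^ (1 / 13 : ℝ) + M ^ (28 / 13 : ℝ) * T ^ (-(7 / 13 : ℝ))) := by
        ring

/-! ## Bourgain's (5.1) for `F = log`, and Theorem 5, from Theorem 4 and Robert–Sargos -/

/-- **The trivial range**: for `T ≥ 1`, `M ≥ 1` and either `M < 24` or `M⁴ < 120 T`,
`‖∑_{M/2 ≤ m ≤ M} e(T log(m/M))‖ ≤ M ≤ 24 √M T^{13/84}` (`√M ≤ (120 T)^{1/8} ≤ 2 T^{13/84}` in the
second case; Bourgain §5: "The cases with `0 ≤ α ≤ 13/42` are trivial (there one can just use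
`|S| ≤ M`)"). [cite: BourgainJAMS2017, §5] -/
theorem norm_bourgainSum_log_small {T M : ℝ} (hT : 1 ≤ T) (hM : 1 ≤ M)
    (h : M < 24 ∨ M ^ 4 < 120 * T) :
    ‖bourgainSum Real.log T M‖ ≤ 24 * Real.sqrt M * T ^ (13 / 84 : ℝ) := by
  have hM0 : 0 < M := by linarith
  have hT0 : 0 < T := by linarith
  refine (norm_bourgainSum_le_self Real.log T hM).trans ?_
  have hsq : M = Real.sqrt M * Real.sqrt M := (Real.mul_self_sqrt hM0.le).symm
  have hs1 : 1 ≤ Real.sqrt M := by rw [← Real.sqrt_one]; exact Real.sqrt_le_sqrt hM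
  have hT84 : 1 ≤ T ^ (13 / 84 : ℝ) := Real.one_le_rpow hT (by norm_num)
  have hs0 : 0 ≤ Real.sqrt M := Real.sqrt_nonneg M
  rcases h with h24 | h120
  · -- `√M ≤ √24 < 5`
    have hs5 : Real.sqrt M ≤ 5 := by
      rw [show (5 : ℝ) = Real.sqrt 25 by rw [show (25 : ℝ) = 5 ^ 2 by norm_num, Real.sqrt_sq (by norm_num)]]
      exact Real.sqrt_le_sqrt (by linarith)
    calc M = Real.sqrt M * Real.sqrt M := hsq
      _ ≤ Real.sqrt M * 5 := mul_le_mul_of_nonneg_left hs5 hs0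
      _ ≤ 24 * Real.sqrt M * 1 := by nlinarith
      _ ≤ 24 * Real.sqrt M * T ^ (13 / 84 : ℝ) := mul_le_mul_of_nonneg_left hT84 (by positivity)
  · -- `√M = (M⁴)^{1/8} ≤ (120 T)^{1/8} ≤ 2 T^{13/84}`
    have h1 : Real.sqrt M = (M ^ 4) ^ (1 / 8 : ℝ) := by
      rw [Real.sqrt_eq_rpow, ← Real.rpow_natCast M 4, ← Real.rpow_mul hM0.le]; norm_num
    have h2 : (M ^ 4) ^ (1 / 8 : ℝ) ≤ (120 * T) ^ (1 / 8 : ℝ) :=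
      Real.rpow_le_rpow (by positivity) h120.le (by norm_num)
    have h120' : (120 : ℝ) ^ (1 / 8 : ℝ) ≤ 2 := by
      calc (120 : ℝ) ^ (1 / 8 : ℝ) ≤ ((2 : ℝ) ^ (8 : ℕ)) ^ (1 / 8 : ℝ) :=
            Real.rpow_le_rpow (by norm_num) (by norm_num) (by norm_num)
        _ = 2 := by rw [← Real.rpow_natCast 2 8, ← Real.rpow_mul (by norm_num)]; norm_num
    have h3 : (120 * T) ^ (1 / 8 : ℝ) ≤ 2 * T ^ (13 / 84 : ℝ) := by
      rw [Real.mul_rpow (by norm_num) hT0.le]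
      exact mul_le_mul h120' (Real.rpow_le_rpow_of_exponent_le hT (by norm_num)) (by positivity)
        (by norm_num)
    calc M = Real.sqrt M * Real.sqrt M := hsq
      _ ≤ Real.sqrt M * (2 * T ^ (13 / 84 : ℝ)) := by
          apply mul_le_mul_of_nonneg_left _ hs0
          rw [h1]; exact h2.trans h3
      _ ≤ 24 * Real.sqrt M * T ^ (13 / 84 : ℝ) := by nlinarith [mul_nonneg hs0 (by positivity : (0:ℝ) ≤ T ^ (13 / 84 : ℝ))]

/-- **The exponent bookkeeping of the Robert–Sargos range**: for `T ≥ 1`, `1 ≤ M ≤ T^{17/42}`,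
`ε > 0`: `M^ε (M^{9/13} T^{1/13} + M^{28/13} T^{-7/13}) ≤ 2 √M T^{13/84 + ε}`
(`(17/42)(5/26) + 1/13 = 13/84` exactly, and `(17/42)(43/26) - 7/13 = 143/1092 < 13/84`).
[cite: BourgainJAMS2017, Theorem 4 (the end-point `17/42`)] -/
theorem rs_range_exponents {T M ε : ℝ} (hT : 1 ≤ T) (hM : 1 ≤ M) (hMT : M ≤ T ^ (17 / 42 : ℝ))
    (hε : 0 < ε) :
    M ^ ε * (M ^ (9 / 13 : ℝ) * T ^ (1 / 13 : ℝ) + M ^ (28 / 13 : ℝ) * T ^ (-(7 / 13 : ℝ))) ≤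
      2 * (Real.sqrt M * T ^ (13 / 84 + ε)) := by
  have hM0 : 0 < M := by linarith
  have hT0 : 0 < T := by linarith
  have hsq : Real.sqrt M = M ^ (1 / 2 : ℝ) := Real.sqrt_eq_rpow M
  -- `M^ε ≤ T^ε`
  have hMT1 : M ≤ T := hMT.trans (by
    calc T ^ (17 / 42 : ℝ) ≤ T ^ (1 : ℝ) := Real.rpow_le_rpow_of_exponent_le hT (by norm_num)
      _ = T := Real.rpow_one T)
  have hε' : M ^ ε ≤ T ^ ε := Real.rpow_le_rpow hM0.le hMT1 hε.le
  -- first term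
  have h1 : M ^ (9 / 13 : ℝ) * T ^ (1 / 13 : ℝ) ≤ Real.sqrt M * T ^ (13 / 84 : ℝ) := by
    have hα : M ^ (5 / 26 : ℝ) ≤ T ^ ((17 / 42 : ℝ) * (5 / 26)) := by
      rw [Real.rpow_mul hT0.le]
      exact Real.rpow_le_rpow hM0.le hMT (by norm_num)
    have e1 : M ^ (9 / 13 : ℝ) = Real.sqrt M * M ^ (5 / 26 : ℝ) := by
      rw [hsq, ← Real.rpow_add hM0]; norm_num
    rw [e1, mul_assoc]
    apply mul_le_mul_of_nonneg_left _ (Real.sqrt_nonneg _)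
    calc M ^ (5 / 26 : ℝ) * T ^ (1 / 13 : ℝ) ≤ T ^ ((17 / 42 : ℝ) * (5 / 26)) * T ^ (1 / 13 : ℝ) :=
          mul_le_mul_of_nonneg_right hα (by positivity)
      _ = T ^ ((17 / 42 : ℝ) * (5 / 26) + 1 / 13) := (Real.rpow_add hT0 _ _).symm
      _ ≤ T ^ (13 / 84 : ℝ) := Real.rpow_le_rpow_of_exponent_le hT (by norm_num)
  -- second term
  have h2 : M ^ (28 / 13 : ℝ) * T ^ (-(7 / 13 : ℝ)) ≤ Real.sqrt M * T ^ (13 / 84 : ℝ) := by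
    have hα : M ^ (43 / 26 : ℝ) ≤ T ^ ((17 / 42 : ℝ) * (43 / 26)) := by
      rw [Real.rpow_mul hT0.le]
      exact Real.rpow_le_rpow hM0.le hMT (by norm_num)
    have e1 : M ^ (28 / 13 : ℝ) = Real.sqrt M * M ^ (43 / 26 : ℝ) := by
      rw [hsq, ← Real.rpow_add hM0]; norm_num
    rw [e1, mul_assoc]
    apply mul_le_mul_of_nonneg_left _ (Real.sqrt_nonneg _)
    calc M ^ (43 / 26 : ℝ) * T ^ (-(7 / 13 : ℝ))
        ≤ T ^ ((17 / 42 : ℝ) * (43 / 26)) * T ^ (-(7 / 13 : ℝ)) :=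
          mul_le_mul_of_nonneg_right hα (by positivity)
      _ = T ^ ((17 / 42 : ℝ) * (43 / 26) + -(7 / 13 : ℝ)) := (Real.rpow_add hT0 _ _).symm
      _ ≤ T ^ (13 / 84 : ℝ) := Real.rpow_le_rpow_of_exponent_le hT (by norm_num)
  have hsplit : T ^ (13 / 84 + ε) = T ^ (13 / 84 : ℝ) * T ^ ε := Real.rpow_add hT0 _ _
  have hpos : 0 ≤ Real.sqrt M * T ^ (13 / 84 : ℝ) := by positivity
  have hsum : M ^ (9 / 13 : ℝ) * T ^ (1 / 13 : ℝ) + M ^ (28 / 13 : ℝ) * T ^ (-(7 / 13 : ℝ)) ≤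
      2 * (Real.sqrt M * T ^ (13 / 84 : ℝ)) := by linarith
  calc M ^ ε * (M ^ (9 / 13 : ℝ) * T ^ (1 / 13 : ℝ) + M ^ (28 / 13 : ℝ) * T ^ (-(7 / 13 : ℝ)))
      ≤ T ^ ε * (2 * (Real.sqrt M * T ^ (13 / 84 : ℝ))) :=
        mul_le_mul hε' hsum (by positivity) (by positivity)
    _ = 2 * (Real.sqrt M * T ^ (13 / 84 + ε)) := by rw [hsplit]; ring

/-- **Bourgain's (5.1) for `F = log` from Theorem 4 and the Robert–Sargos test only**
(`Literature.NumberTheory.LFunctions.Bourgain2017_eq51_log`: `‖S‖ ≤ C √M T^{13/84 + ε}` for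
`T ≥ T₀`, `1 ≤ M ≤ √T`): Theorem 4 on `T^{17/42} ≤ M ≤ √T`; the Robert–Sargos test
(`norm_bourgainSum_log_le_of_sargos`, `rs_range_exponents`) on `24 ≤ M < T^{17/42}`,
`M⁴ ≥ 120 T`; the trivial bound (`norm_bourgainSum_log_small`) otherwise. This replaces the use
of Huxley's (4.1) and of the exponent pair (4.2) in §5 of the paper.
[cite: BourgainJAMS2017, §5–§6 eq. (5.1)] -/
theorem Bourgain2017_eq51_log_of_theorem4_of_sargos (h4 : Bourgain2017_theorem4_log)
    (hS : Sargos2003_lemma4) : Bourgain2017_eq51_log := by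
  intro ε hε
  obtain ⟨C₁, T₁, H₁⟩ := h4 ε hε
  obtain ⟨C₂, H₂⟩ := norm_bourgainSum_log_le_of_sargos hS hε
  refine ⟨|C₁| + 2 * |C₂| + 24, max T₁ 1, ?_⟩
  intro T hT M hM1 hMT
  have hT₁ : T₁ ≤ T := (le_max_left _ _).trans hT
  have hT1 : (1 : ℝ) ≤ T := (le_max_right _ _).trans hT
  have hT0 : 0 < T := by linarith
  have hY : 0 ≤ Real.sqrt M * T ^ (13 / 84 + ε) := by positivity
  have finish : ∀ D : ℝ, D ≤ |C₁| + 2 * |C₂| + 24 →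
      ‖bourgainSum Real.log T M‖ ≤ D * (Real.sqrt M * T ^ (13 / 84 + ε)) →
      ‖bourgainSum Real.log T M‖ ≤ (|C₁| + 2 * |C₂| + 24) * Real.sqrt M * T ^ (13 / 84 + ε) := by
    intro D hD h
    calc ‖bourgainSum Real.log T M‖ ≤ D * (Real.sqrt M * T ^ (13 / 84 + ε)) := h
      _ ≤ (|C₁| + 2 * |C₂| + 24) * (Real.sqrt M * T ^ (13 / 84 + ε)) :=
          mul_le_mul_of_nonneg_right hD hY
      _ = (|C₁| + 2 * |C₂| + 24) * Real.sqrt M * T ^ (13 / 84 + ε) := by ring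
  by_cases hA : T ^ (17 / 42 : ℝ) ≤ M
  · -- Theorem 4
    refine finish |C₁| (by linarith [abs_nonneg C₂]) ?_
    calc ‖bourgainSum Real.log T M‖ ≤ C₁ * Real.sqrt M * T ^ (13 / 84 + ε) := H₁ T hT₁ M hA hMT
      _ = C₁ * (Real.sqrt M * T ^ (13 / 84 + ε)) := by ring
      _ ≤ |C₁| * (Real.sqrt M * T ^ (13 / 84 + ε)) :=
          mul_le_mul_of_nonneg_right (le_abs_self _) hY
  · rw [not_le] at hA
    by_cases hB : 24 ≤ M ∧ 120 * T ≤ M ^ 4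
    · -- the Robert–Sargos test
      refine finish (2 * |C₂|) (by linarith [abs_nonneg C₁]) ?_
      have hin0 : 0 ≤ M ^ ε * (M ^ (9 / 13 : ℝ) * T ^ (1 / 13 : ℝ) +
          M ^ (28 / 13 : ℝ) * T ^ (-(7 / 13 : ℝ))) := by
        have : 0 < M := by linarith
        positivity
      calc ‖bourgainSum Real.log T M‖
          ≤ C₂ * M ^ ε * (M ^ (9 / 13 : ℝ) * T ^ (1 / 13 : ℝ) + M ^ (28 / 13 : ℝ) * T ^ (-(7 / 13 : ℝ))) :=
            H₂ T hT1 M hB.1 hB.2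
        _ = C₂ * (M ^ ε * (M ^ (9 / 13 : ℝ) * T ^ (1 / 13 : ℝ) + M ^ (28 / 13 : ℝ) * T ^ (-(7 / 13 : ℝ)))) := by
            ring
        _ ≤ |C₂| * (M ^ ε * (M ^ (9 / 13 : ℝ) * T ^ (1 / 13 : ℝ) + M ^ (28 / 13 : ℝ) * T ^ (-(7 / 13 : ℝ)))) :=
            mul_le_mul_of_nonneg_right (le_abs_self _) hin0
        _ ≤ |C₂| * (2 * (Real.sqrt M * T ^ (13 / 84 + ε))) :=
            mul_le_mul_of_nonneg_left (rs_range_exponents hT1 hM1 hA.le hε) (abs_nonneg _)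
        _ = 2 * |C₂| * (Real.sqrt M * T ^ (13 / 84 + ε)) := by ring
    · -- the trivial range
      refine finish 24 (by linarith [abs_nonneg C₁, abs_nonneg C₂]) ?_
      have hcase : M < 24 ∨ M ^ 4 < 120 * T := by
        rcases not_and_or.1 hB with hc | hc
        · exact Or.inl (not_le.1 hc)
        · exact Or.inr (not_le.1 hc)
      have key := norm_bourgainSum_log_small hT1 hM1 hcase
      have hmono : T ^ (13 / 84 : ℝ) ≤ T ^ (13 / 84 + ε) :=
        Real.rpow_le_rpow_of_exponent_le hT1 (by linarith)
      calc ‖bourgainSum Real.log T M‖ ≤ 24 * Real.sqrt M * T ^ (13 / 84 : ℝ) := key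
        _ ≤ 24 * Real.sqrt M * T ^ (13 / 84 + ε) :=
            mul_le_mul_of_nonneg_left hmono (by positivity)
        _ = 24 * (Real.sqrt M * T ^ (13 / 84 + ε)) := by ring

/-- **Bourgain's Theorem 5 from Theorem 4 and the Robert–Sargos test, given (4.3)**.
[cite: BourgainJAMS2017, Theorem 5] -/
theorem bourgain_subconvexity_of_theorem4_of_sargos_of_eq43 (h4 : Bourgain2017_theorem4_log)
    (hS : Sargos2003_lemma4) (h43 : Bourgain2017_eq43) : bourgain_subconvexity :=
  bourgain_subconvexity_of_eq43_of_eq51 h43 (Bourgain2017_eq51_log_of_theorem4_of_sargos h4 hS)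

/-- **The frontier of the discharge of Bourgain's Theorem 5**:
`Literature.NumberTheory.LFunctions.bourgain_subconvexity` follows from Bourgain's Theorem 4
(`ℓ²`-decoupling + Bombieri–Iwaniec–Huxley–Watt, eq. (3.19) on `17/42 ≤ α ≤ 1/2`) and the
Robert–Sargos fourth-derivative test alone — the approximate functional equation (4.3) is the
theorem `Literature.NumberTheory.LFunctions.Bourgain2017_eq43_holds`, and Huxley's (4.1), the
exponent pair (4.2) and the classical fourth-derivative test are no longer used.
[cite: BourgainJAMS2017, Theorem 5] -/
theorem bourgain_subconvexity_of_theorem4_of_sargos (h4 : Bourgain2017_theorem4_log)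
    (hS : Sargos2003_lemma4) : bourgain_subconvexity :=
  bourgain_subconvexity_of_theorem4_of_sargos_of_eq43 h4 hS Bourgain2017_eq43_holds

end Literature.NumberTheory.LFunctions
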